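import Summits.BirchSwinnertonDyer.Rank1Residual.X11b.BDPRouteControlSnake
import Summits.BirchSwinnertonDyer.Rank1Residual.X11b.LocalTrivialityBridge
import HarnessLib

/-!
# Class X11b, route p2 ("BDP + converse-theorem engine + Kolyvagin"): the counting snake lemma
# WITH the strict place `𝔭` among the counted kernels —
# `#Sel_𝔭^Σ(K_∞, E[p^∞])^Γ ≤ #Sel_𝔭^Σ(K, E[p^∞]) · ∏_{v ∈ T} #ker r_v`, `𝔭 ∈ T`, NO hypothesis at `𝔭`
# (cell `b2b-bsdres`, sub-cell `multr1-p2`, gen 17)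

HONEST FRAMING (verbatim, cell `b2b-bsdres`): the goal of the cell is to DELETE the
COMBINATION-SHAPED residual classes for ALL analytic-rank `≤ 1` curves over `ℚ` — "full BSD
formula for every rank `≤ 1` curve in class `C`" assembled STRICTLY from published theorems — so
that the rank-`≤ 1` remainder becomes exactly the CONSTRUCTION-SHAPED classes, which are TYPED
(missing-input Props), NOT attempted; this is not "finishing BSD". Research route `p2` for class
X11b; no claim beyond the stated class; nothing booked; X11b stays CONSTRUCTION-SHAPED. Theorems
only; no definition; no named fact; no `sorry`. Continues `BDPRouteControlSnake.lean` (gen 13).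

## Why

The gen-13 counting snake lemma `finite_endInvariants_and_natCard_le_of_localKer` carries the
hypothesis `E(K̄)[p^∞]^{D_𝔭 ⊓ ker κ} = 0` — no `p`-power torsion over the completed tower `K_{∞,w}`
at the STRICT place `𝔭` — under which Castella's strict condition at `𝔭` DESCENDS from `K_∞` to
`K` (the `𝔭`-component of Greenberg's `ker g` vanishes). On the pairs of X11b where the erratum's
hypothesis (iv) `E(ℚ_p)[p] = 0` FAILS (split multiplicative at `p`, Tate period a `p`-th power)
that hypothesis is false, and the statement of record (`P2.bsdp_of_onTree_selmer_split`, gen 16)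
still types the PUB-shaped control input there. Greenberg's proof (LNM 1716 §3, p. 90) does not
need the vanishing: the `𝔭`-component of `ker g` is the local kernel
`ker r_𝔭 = ker (H¹(K_𝔭, E[p^∞]) → H¹(K_{∞,w}, E[p^∞]))`, a finite group like the `ker r_v` at the
bad `v ∤ p`, and it simply joins the product. This file proves that form:

* `mem_strictKer_strictDatum_iff_mem_awayKer` — for ANY `H ≤ Γ_K` and discrete `M`, Castella's
  strict condition for the datum `M⁺_𝔭 = 0` IS local triviality at (the chosen place above) `𝔭`:
  `(strictDatum M 𝔭).strictKer H = awayKer H M 𝔭` (the strict map is the map of the pair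
  `(H ⊓ D_𝔭 ↪ H, M ↠ M ⧸ 0)`; sibling's `topEquivH1_mem_strictKer_strictDatum_iff` is the case `H = ⊤`).
* `resOfLe_mem_localKer_strict_of_mem_selmerAcPreimage` — a class of `A = res⁻¹(Sel_𝔭^Σ(K_∞, E[p^∞]))`
  localises at `𝔭` into `ker r_𝔭`.
* `mem_selmerAcBase_iff_locAtFinset_eq_zero_strict` — for `T ∋ 𝔭` (other members finite, `∤ p`,
  `∉ Σ`) and away descent off `T`: `c ∈ A` lies in `Sel_𝔭^Σ(K, E[p^∞])` iff its localisations at `T`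
  vanish — NO hypothesis at `𝔭`.
* **`finite_endInvariants_and_natCard_le_of_localKer_strict`** — the counting snake lemma with
  `𝔭 ∈ T`: `#Sel^γ ≤ #Sel_𝔭^Σ(K, E[p^∞]) · ∏_{v ∈ T} #ker r_v`; `natCard_endInvariants_le_pow_of_localKer_strict`
  (`p`-power form) and **`controlUpperOnTreeAt_of_localKer_bounds_strict`**: route p2's (CTL≤)ᵗ at a
  datum from (c) kernel bounds on `T ∋ 𝔭` and (d) one Selmer bound, with NO torsion hypothesis at `𝔭`.

The bound `#ker r_𝔭 ≤ #E(K_𝔭)[p^∞]` (Greenberg's Lemma 3.3 at a prime above `p`, strict condition)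
is `BDPRouteLocalKernelAtP.lean`. CONDITIONAL downstream use only; nothing booked; labels unchanged.

References: [GreenbergLNM1716] §3 pp. 85–87, 90 (the maps `r_v`, `ker g ⊆ ⊕ ker r_v`, Lemma 3.2);
[Castella2018] Def. 2.2, Thm. 2.3 (arXiv:1704.06608 p. 5); [JetchevSkinnerWan2017] §3.3 (shape).
-/

noncomputable section

open scoped Classical

open NumberField IsDedekindDomain Field
open Literature.NumberTheory.EllipticCurves Literature.NumberTheory.EllipticCurves.GreenbergSelmer
open Literature.NumberTheory.GaloisRepresentations

universe u

namespace Summit.BirchSwinnertonDyer.Rank1Residual.X11b.AcSelmer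

/-! ## The strict condition for `M⁺_𝔭 = 0` is local triviality at `𝔭` -/

section Strict

variable {K : Type u} [Field K] [NumberField K]
variable (H : Subgroup (absoluteGaloisGroup K)) (M : Type u) [AddCommGroup M]
  [DistribMulAction (absoluteGaloisGroup K) M] [TopologicalSpace M] [DiscreteTopology M]

/-- **Castella's strict condition at `𝔭` (datum `M⁺_𝔭 = 0`) is local triviality at the chosen place
above `𝔭`**, for every `H ≤ Γ_K` (`L = K̄^H`): `c ∈ (strictDatum M 𝔭).strictKer H ↔ c ∈ awayKer H M 𝔭`.
Both are kernels of maps of pairs out of `H¹(H, M)` with bijective coefficient maps (`M ↠ M ⧸ 0`,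
`id_M`) and group maps with the same range `H ⊓ D_𝔭` (sibling's `resH1Hom_eq_zero_iff_of_range_eq`).
"`H¹_ac(K_w, V) := 0` if `w = 𝔭`". [cite: Castella2018, §2.1 and Def. 2.2 (arXiv:1704.06608 p. 5)]
[cite: Greenberg1989, §1 p. 98 (strict condition)] -/
theorem mem_strictKer_strictDatum_iff_mem_awayKer (𝔭 : HeightOneSpectrum (𝓞 K)) (c : subgroupH1 H M) :
    c ∈ (strictDatum M 𝔭).strictKer H ↔ c ∈ awayKer H M 𝔭 := by
  rw [LocalDatum.mem_strictKer_iff, LocalDatum.strictMap, awayKer, AddMonoidHom.mem_ker,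
    Literature.NumberTheory.EllipticCurves.resOfLe]
  have hbij : Function.Bijective ((strictDatum M 𝔭).grMk) := by
    refine ⟨fun a b hab ↦ ?_, (strictDatum M 𝔭).grMk_surjective⟩
    have h : a - b ∈ (strictDatum M 𝔭).grMk.ker := by
      rw [AddMonoidHom.mem_ker, map_sub, sub_eq_zero]; exact hab
    rw [LocalDatum.ker_grMk] at h
    exact sub_eq_zero.mp (AddSubgroup.mem_bot.mp h)
  refine LocBridge.resH1Hom_eq_zero_iff_of_range_eq _ _ _ hbij _ _ _ Function.bijective_id ?_ _
  ext g
  simp only [Set.mem_range]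
  constructor
  · rintro ⟨x, rfl⟩
    exact ⟨⟨(x : decomp 𝔭), Subgroup.mem_inf.mpr ⟨(mem_decompIn_iff H 𝔭 x).1 x.2, (x : decomp 𝔭).2⟩⟩,
      rfl⟩
  · rintro ⟨x, rfl⟩
    exact ⟨⟨⟨(x : absoluteGaloisGroup K), (Subgroup.mem_inf.mp x.2).2⟩,
      (mem_decompIn_iff H 𝔭 _).2 (Subgroup.mem_inf.mp x.2).1⟩, rfl⟩

/-- `Sel_𝔭^Σ(L, M)` membership with the strict condition spelled as local triviality at `𝔭`.
[cite: Castella2018, Def. 2.2 (arXiv:1704.06608 p. 5)] -/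
theorem mem_selmerOver_iff_awayKer [H.Normal] {p : ℕ} {𝔭 : HeightOneSpectrum (𝓞 K)}
    {S : Set (HeightOneSpectrum (𝓞 K))} (c : subgroupH1 H M) :
    c ∈ selmerOver H M p 𝔭 S ↔
      (∀ (v : HeightOneSpectrum (𝓞 K)), ((p : ℕ) : 𝓞 K) ∉ v.asIdeal → v ∉ S →
          ∀ σ : absoluteGaloisGroup K, conjH1 H M σ c ∈ awayKer H M v) ∧
        (∀ (w : InfinitePlace K) (σ : absoluteGaloisGroup K), conjH1 H M σ c ∈ infKer H M w) ∧
        ∀ σ : absoluteGaloisGroup K, conjH1 H M σ c ∈ awayKer H M 𝔭 := by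
  rw [mem_selmerOver_iff]
  simp only [mem_strictKer_strictDatum_iff_mem_awayKer]

end Strict

/-! ## Classes of `A` localise into `ker r_𝔭`; membership in `Sel_𝔭^Σ(K)` with `𝔭 ∈ T` -/

section Preimage

variable {K : Type} [Field K] [NumberField K]
variable {W : WeierstrassCurve K} {p : ℕ} [Fact p.Prime] {κ : ZpExtension K p}
  {𝔭 : HeightOneSpectrum (𝓞 K)} {S : Set (HeightOneSpectrum (𝓞 K))}

/-- **A class of `A = res⁻¹(Sel_𝔭^Σ(K_∞, E[p^∞]))` localises at the strict place `𝔭` into `ker r_𝔭`**: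
its restriction to `K_∞` is strict, i.e. locally trivial, at the chosen place above `𝔭`.
[cite: GreenbergLNM1716, §3 p. 90 ("`ker g_n` … `⊕ ker r_v`")] [cite: Castella2018, Def. 2.2 (arXiv:1704.06608 p. 5)] -/
theorem resOfLe_mem_localKer_strict_of_mem_selmerAcPreimage
    {c : W.subgroupH1 p (⊤ : Subgroup (absoluteGaloisGroup K))}
    (hc : c ∈ selmerAcPreimage W p κ 𝔭 S) :
    resOfLe (W.geomPrimaryTorsion p)
        (inf_le_left : (⊤ : Subgroup (absoluteGaloisGroup K)) ⊓ decomp 𝔭 ≤ ⊤) c ∈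
      localKer κ.kerSubgroup (W.geomPrimaryTorsion p) 𝔭 := by
  rw [resOfLe_mem_localKer_iff]
  have h1 := ((mem_selmerOver_iff_awayKer _ _ _).mp ((mem_selmerAcPreimage_iff c).mp hc)).2.2 1
  rwa [conjH1_one_holds, AddMonoidHom.id_apply] at h1

omit [Fact p.Prime] in
/-- A class of `Sel_𝔭^Σ(K, E[p^∞])` is locally trivial at `𝔭` over `K` (the strict condition, `σ = 1`).
[cite: Castella2018, Def. 2.2 (arXiv:1704.06608 p. 5)] -/
theorem mem_awayKer_strict_of_mem_selmerAcBase
    {c : W.subgroupH1 p (⊤ : Subgroup (absoluteGaloisGroup K))} (hc : c ∈ selmerAcBase W p 𝔭 S) :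
    c ∈ awayKer ⊤ (W.geomPrimaryTorsion p) 𝔭 := by
  have h1 := ((mem_selmerOver_iff_awayKer _ _ _).mp hc).2.2 1
  rwa [conjH1_one_holds, AddMonoidHom.id_apply] at h1

/-- **`ker (ψ|_A) = Sel_𝔭^Σ(K, E[p^∞])` with `𝔭 ∈ T`, NO hypothesis at `𝔭`.** For totally complex `K`,
a finite set `T ∋ 𝔭` of finite places, all `∉ Σ` and (apart from `𝔭`) not above `p`, and away
descent outside `T`: a class `c ∈ A` lies in `Sel_𝔭^Σ(K, E[p^∞])` iff its localisations at `T`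
vanish (the strict condition over `K` IS the vanishing of the localisation at `𝔭`).
[cite: GreenbergLNM1716, §3 pp. 85–86, 90] [cite: Castella2018, Def. 2.2 (arXiv:1704.06608 p. 5)] -/
theorem mem_selmerAcBase_iff_locAtFinset_eq_zero_strict [IsTotallyComplex K]
    {T : Finset (HeightOneSpectrum (𝓞 K))} (h𝔭T : 𝔭 ∈ T)
    (hTp : ∀ v ∈ T, v ≠ 𝔭 → ((p : ℕ) : 𝓞 K) ∉ v.asIdeal) (hTS : ∀ v ∈ T, v ∉ S)
    (hS : ∀ c : W.subgroupH1 p (⊤ : Subgroup (absoluteGaloisGroup K)),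
      W.resOfLe p (le_top : κ.kerSubgroup ≤ ⊤) c ∈ selmerAc W p κ 𝔭 S →
        ∀ v : HeightOneSpectrum (𝓞 K), ((p : ℕ) : 𝓞 K) ∉ v.asIdeal → v ∉ S → v ∉ T →
          c ∈ awayKer ⊤ (W.geomPrimaryTorsion p) v)
    {c : W.subgroupH1 p (⊤ : Subgroup (absoluteGaloisGroup K))}
    (hc : c ∈ selmerAcPreimage W p κ 𝔭 S) :
    c ∈ selmerAcBase W p 𝔭 S ↔ locAtFinset W p T c = 0 := by
  have hcSel : W.resOfLe p (le_top : κ.kerSubgroup ≤ ⊤) c ∈ selmerAc W p κ 𝔭 S :=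
    (mem_selmerAcPreimage_iff c).mp hc
  constructor
  · intro h
    funext v
    rw [locAtFinset_apply, Pi.zero_apply]
    by_cases hv : (v : HeightOneSpectrum (𝓞 K)) = 𝔭
    · refine (mem_awayKer_top_iff (v : HeightOneSpectrum (𝓞 K)) c).mp ?_
      rw [hv]
      exact mem_awayKer_strict_of_mem_selmerAcBase h
    · exact (mem_awayKer_top_iff (v : HeightOneSpectrum (𝓞 K)) c).mp
        (mem_awayKer_of_mem_selmerAcBase h (hTp v v.2 hv) (hTS v v.2))
  · intro h
    have hconj : ∀ σ : absoluteGaloisGroup K, conjH1 ⊤ (W.geomPrimaryTorsion p) σ c = c := fun σ ↦ by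
      rw [conjH1_of_mem_holds ⊤ (W.geomPrimaryTorsion p) (Subgroup.mem_top σ), AddMonoidHom.id_apply]
    change c ∈ selmerOver ⊤ (W.geomPrimaryTorsion p) p 𝔭 S
    rw [mem_selmerOver_iff_awayKer ⊤ (W.geomPrimaryTorsion p)]
    simp only [hconj]
    refine ⟨fun v hv hvS _ ↦ ?_, fun w _ ↦ ?_, fun _ ↦ ?_⟩
    · by_cases hvT : v ∈ T
      · have hv0 := congr_fun h ⟨v, hvT⟩
        rw [locAtFinset_apply, Pi.zero_apply] at hv0
        exact (mem_awayKer_top_iff v c).mpr hv0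
      · exact hS c hcSel v hv hvS hvT
    · exact infConditions_descend_of_isTotallyComplex W p κ 𝔭 S c hcSel w
    · have hv0 := congr_fun h ⟨𝔭, h𝔭T⟩
      rw [locAtFinset_apply, Pi.zero_apply] at hv0
      exact (mem_awayKer_top_iff 𝔭 c).mpr hv0

/-- A class of `A` localises into `ker r_v` at every `v ∈ T` (`T ∋ 𝔭` as above: at `v ≠ 𝔭` by the
away condition over `K_∞`, at `v = 𝔭` by the strict one). [cite: GreenbergLNM1716, §3 p. 90 ("`ker g_n` … `⊕ ker r_v`")] -/
theorem resOfLe_mem_localKer_of_mem_selmerAcPreimage_strict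
    {T : Finset (HeightOneSpectrum (𝓞 K))}
    (hTp : ∀ v ∈ T, v ≠ 𝔭 → ((p : ℕ) : 𝓞 K) ∉ v.asIdeal) (hTS : ∀ v ∈ T, v ∉ S)
    {c : W.subgroupH1 p (⊤ : Subgroup (absoluteGaloisGroup K))}
    (hc : c ∈ selmerAcPreimage W p κ 𝔭 S) (v : T) :
    resOfLe (W.geomPrimaryTorsion p)
        (inf_le_left : (⊤ : Subgroup (absoluteGaloisGroup K)) ⊓
          decomp (v : HeightOneSpectrum (𝓞 K)) ≤ ⊤) c ∈
      localKer κ.kerSubgroup (W.geomPrimaryTorsion p) v := by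
  by_cases hv : (v : HeightOneSpectrum (𝓞 K)) = 𝔭
  · rw [hv]
    exact resOfLe_mem_localKer_strict_of_mem_selmerAcPreimage hc
  · exact resOfLe_mem_localKer_of_mem_selmerAcPreimage hc (hTp v v.2 hv) (hTS v v.2)

end Preimage

/-! ## The counting snake lemma with `𝔭 ∈ T` -/

section Count

variable {K : Type} [Field K] [NumberField K]
variable {W : WeierstrassCurve K} {p : ℕ} [Fact p.Prime] {κ : ZpExtension K p}
  {𝔭 : HeightOneSpectrum (𝓞 K)} {S : Set (HeightOneSpectrum (𝓞 K))}

/-- **The counting snake lemma with the strict place counted (Greenberg §3 / JSW §3.3).** For `E`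
over a totally complex `K`, `κ` with topological generator `γ`, `𝔭`, `Σ`, a finite set `T ∋ 𝔭` of
finite places, all `∉ Σ` and (apart from `𝔭`) not above `p`: if the away conditions descend at every
finite `v ∤ p` outside `Σ ∪ T`, and `Sel_𝔭^Σ(K, E[p^∞])` and the `ker r_v` (`v ∈ T`, INCLUDING
`ker r_𝔭`) are finite, then `Sel_𝔭^Σ(K_∞, E[p^∞])^γ` is finite and
`#Sel^γ ≤ #Sel_𝔭^Σ(K, E[p^∞]) · ∏_{v∈T} #ker r_v`. NO hypothesis on the `p`-power torsion over
`K_{∞,w}`: the `𝔭`-component of `ker g` is `ker r_𝔭`, counted like the others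
(`res : A ↠ Sel^γ` by Lemma 3.2; `ψ|_A` has kernel `Sel_𝔭^Σ(K)` and image in `∏ ker r_v`).
[cite: GreenbergLNM1716, §3 pp. 85–86 (snake lemma) and p. 90 (Lemma 3.5, Thm. 1.2)]
[cite: JetchevSkinnerWan2017, §3.3 and Thm. 3.3.1 (control; shape only)] -/
theorem finite_endInvariants_and_natCard_le_of_localKer_strict [IsTotallyComplex K]
    {γ : absoluteGaloisGroup K} (hγ : κ.IsTopGenerator γ)
    (T : Finset (HeightOneSpectrum (𝓞 K))) (h𝔭T : 𝔭 ∈ T)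
    (hTp : ∀ v ∈ T, v ≠ 𝔭 → ((p : ℕ) : 𝓞 K) ∉ v.asIdeal) (hTS : ∀ v ∈ T, v ∉ S)
    (hS : ∀ c : W.subgroupH1 p (⊤ : Subgroup (absoluteGaloisGroup K)),
      W.resOfLe p (le_top : κ.kerSubgroup ≤ ⊤) c ∈ selmerAc W p κ 𝔭 S →
        ∀ v : HeightOneSpectrum (𝓞 K), ((p : ℕ) : 𝓞 K) ∉ v.asIdeal → v ∉ S → v ∉ T →
          c ∈ awayKer ⊤ (W.geomPrimaryTorsion p) v)
    [Finite (selmerAcBase W p 𝔭 S)]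
    (hfin : ∀ v ∈ T, Finite (localKer κ.kerSubgroup (W.geomPrimaryTorsion p) v)) :
    Finite (IwasawaDual.endInvariants (conjSelmerAc W p κ 𝔭 S γ - 1)) ∧
      Nat.card (IwasawaDual.endInvariants (conjSelmerAc W p κ 𝔭 S γ - 1)) ≤
        Nat.card (selmerAcBase W p 𝔭 S) *
          ∏ v ∈ T, Nat.card (localKer κ.kerSubgroup (W.geomPrimaryTorsion p) v) := by
  set A := selmerAcPreimage W p κ 𝔭 S
  -- the localisation restricted to `A`; (1) its image lies in `∏ ker r_v`
  set ψ : A →+ Π v : T, subgroupH1 ((⊤ : Subgroup (absoluteGaloisGroup K)) ⊓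
      decomp (v : HeightOneSpectrum (𝓞 K))) (W.geomPrimaryTorsion p) :=
    (locAtFinset W p T).comp A.subtype
  have hrange : ∀ (a : A) (v : T), ψ a v ∈ localKer κ.kerSubgroup (W.geomPrimaryTorsion p) v :=
    fun a v ↦ resOfLe_mem_localKer_of_mem_selmerAcPreimage_strict hTp hTS a.2 v
  -- (2) the kernel is `Sel_𝔭^Σ(K, E[p^∞])`
  have hker : ∀ a : A, a ∈ ψ.ker ↔ (a : W.subgroupH1 p ⊤) ∈ selmerAcBase W p 𝔭 S := by
    intro a
    rw [AddMonoidHom.mem_ker, mem_selmerAcBase_iff_locAtFinset_eq_zero_strict h𝔭T hTp hTS hS a.2]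
    rfl
  -- (3) finiteness and count of `im ψ`
  haveI hfinT : ∀ v : T, Finite (localKer κ.kerSubgroup (W.geomPrimaryTorsion p)
      (v : HeightOneSpectrum (𝓞 K))) := fun v ↦ hfin v v.2
  let e : ψ.range → Π v : T, localKer κ.kerSubgroup (W.geomPrimaryTorsion p)
      (v : HeightOneSpectrum (𝓞 K)) :=
    fun y ↦ fun v ↦ ⟨y.1 v, by
      obtain ⟨a, ha⟩ := y.2
      rw [← ha]
      exact hrange a v⟩
  have he : Function.Injective e := by
    intro y₁ y₂ h
    apply Subtype.ext
    funext v
    simpa [e] using congrArg Subtype.val (congr_fun h v)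
  haveI : Finite ψ.range := Finite.of_injective e he
  have hcard_range : Nat.card ψ.range ≤
      ∏ v ∈ T, Nat.card (localKer κ.kerSubgroup (W.geomPrimaryTorsion p) v) := by
    calc Nat.card ψ.range
        ≤ Nat.card (Π v : T, localKer κ.kerSubgroup (W.geomPrimaryTorsion p)
            (v : HeightOneSpectrum (𝓞 K))) := Nat.card_le_card_of_injective e he
      _ = ∏ v : T, Nat.card (localKer κ.kerSubgroup (W.geomPrimaryTorsion p)
            (v : HeightOneSpectrum (𝓞 K))) := Nat.card_pi
      _ = ∏ v ∈ T, Nat.card (localKer κ.kerSubgroup (W.geomPrimaryTorsion p) v) :=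
          Finset.prod_coe_sort T fun v ↦
            Nat.card (localKer κ.kerSubgroup (W.geomPrimaryTorsion p) v)
  -- (4) finiteness and count of `ker ψ`
  let f : ψ.ker → selmerAcBase W p 𝔭 S := fun a ↦ ⟨((a : A) : W.subgroupH1 p ⊤), (hker a).mp a.2⟩
  have hf : Function.Injective f := by
    intro a₁ a₂ h
    apply Subtype.ext; apply Subtype.ext
    simpa [f] using congrArg (fun x : selmerAcBase W p 𝔭 S ↦ (x : W.subgroupH1 p ⊤)) h
  haveI : Finite ψ.ker := Finite.of_injective f hf
  have hcard_ker : Nat.card ψ.ker ≤ Nat.card (selmerAcBase W p 𝔭 S) :=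
    Nat.card_le_card_of_injective f hf
  -- (5) `A` is finite and `#A ≤ #Sel(K) · ∏ #ker r_v`
  haveI : Finite (A ⧸ ψ.ker) :=
    Finite.of_equiv _ (QuotientAddGroup.quotientKerEquivRange ψ).toEquiv.symm
  haveI : Finite A :=
    Finite.of_equiv _ (AddSubgroup.addGroupEquivQuotientProdAddSubgroup (s := ψ.ker)).symm
  have hcardA : Nat.card A ≤ Nat.card (selmerAcBase W p 𝔭 S) *
      ∏ v ∈ T, Nat.card (localKer κ.kerSubgroup (W.geomPrimaryTorsion p) v) := by
    rw [AddSubgroup.card_eq_card_quotient_mul_card_addSubgroup ψ.ker,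
      Nat.card_congr (QuotientAddGroup.quotientKerEquivRange ψ).toEquiv, mul_comm]
    exact Nat.mul_le_mul hcard_ker hcard_range
  -- (6) `res : A ↠ Sel^γ`
  let g : A → IwasawaDual.endInvariants (conjSelmerAc W p κ 𝔭 S γ - 1) := fun a ↦
    ⟨⟨W.resOfLe p (le_top : κ.kerSubgroup ≤ ⊤) (a : W.subgroupH1 p ⊤),
        (mem_selmerAcPreimage_iff _).mp a.2⟩, by
      rw [IwasawaDual.mem_endInvariants_iff, IwasawaDual.End_sub_apply, AddMonoid.End.one_apply,
        sub_eq_zero]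
      exact Subtype.ext (conjH1_resOfLe_top γ (a : W.subgroupH1 p ⊤))⟩
  have hg : Function.Surjective g := by
    intro x
    obtain ⟨c, hcA, hc⟩ := exists_mem_selmerAcPreimage_resOfLe_eq hγ x
    exact ⟨⟨c, hcA⟩, Subtype.ext (Subtype.ext hc)⟩
  exact ⟨Finite.of_surjective g hg, (Nat.card_le_card_of_surjective g hg).trans hcardA⟩

/-- **Counting form with `p`-power bounds, `𝔭 ∈ T`**: `#Sel_𝔭^Σ(K, E[p^∞]) ≤ p^a` and
`#ker r_v ≤ p^{b v}` (`v ∈ T`, including `v = 𝔭`) give `#Sel_𝔭^Σ(K_∞, E[p^∞])^γ ≤ p^{a + ∑_{v∈T} b v}`.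
[cite: GreenbergLNM1716, §3 p. 90] -/
theorem natCard_endInvariants_le_pow_of_localKer_strict [IsTotallyComplex K]
    {γ : absoluteGaloisGroup K} (hγ : κ.IsTopGenerator γ)
    (T : Finset (HeightOneSpectrum (𝓞 K))) (h𝔭T : 𝔭 ∈ T)
    (hTp : ∀ v ∈ T, v ≠ 𝔭 → ((p : ℕ) : 𝓞 K) ∉ v.asIdeal) (hTS : ∀ v ∈ T, v ∉ S)
    (hS : ∀ c : W.subgroupH1 p (⊤ : Subgroup (absoluteGaloisGroup K)),
      W.resOfLe p (le_top : κ.kerSubgroup ≤ ⊤) c ∈ selmerAc W p κ 𝔭 S →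
        ∀ v : HeightOneSpectrum (𝓞 K), ((p : ℕ) : 𝓞 K) ∉ v.asIdeal → v ∉ S → v ∉ T →
          c ∈ awayKer ⊤ (W.geomPrimaryTorsion p) v)
    [Finite (selmerAcBase W p 𝔭 S)]
    (hfin : ∀ v ∈ T, Finite (localKer κ.kerSubgroup (W.geomPrimaryTorsion p) v))
    {a : ℕ} (ha : Nat.card (selmerAcBase W p 𝔭 S) ≤ p ^ a) {b : HeightOneSpectrum (𝓞 K) → ℕ}
    (hb : ∀ v ∈ T, Nat.card (localKer κ.kerSubgroup (W.geomPrimaryTorsion p) v) ≤ p ^ b v) :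
    Finite (IwasawaDual.endInvariants (conjSelmerAc W p κ 𝔭 S γ - 1)) ∧
      Nat.card (IwasawaDual.endInvariants (conjSelmerAc W p κ 𝔭 S γ - 1)) ≤
        p ^ (a + ∑ v ∈ T, b v) := by
  obtain ⟨hfinγ, hle⟩ :=
    finite_endInvariants_and_natCard_le_of_localKer_strict hγ T h𝔭T hTp hTS hS hfin
  refine ⟨hfinγ, hle.trans ?_⟩
  rw [pow_add, ← Finset.prod_pow_eq_pow_sum]
  exact Nat.mul_le_mul ha (Finset.prod_le_prod' fun v hv ↦ hb v hv)

end Count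

end Summit.BirchSwinnertonDyer.Rank1Residual.X11b.AcSelmer

namespace Summit.BirchSwinnertonDyer.Rank1Residual.X11b

/-! ## Route p2: (CTL≤)ᵗ at a datum with the kernel at `𝔭` counted, not assumed away -/
section RouteP2

open AcSelmer WeierstrassCurve Literature.NumberTheory.EllipticCurves.Rank1Residual
  Literature.NumberTheory.QuadraticFields.Quadratic

variable {W : WeierstrassCurve ℚ} [W.IsElliptic] [W.IsGloballyMinimal] {K : Type} [Field K]
  [NumberField K] {p : ℕ} [Fact p.Prime] {κ : ZpExtension K p} {𝔭 : HeightOneSpectrum (𝓞 K)}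
  {γ : Field.absoluteGaloisGroup K} [Fact (κ.IsTopGenerator γ)] {ι : K →+* ℚ_[p]}

/-- **(CTL≤)ᵗ — route p2's algebraic input at a datum — with the strict place's kernel COUNTED.**
For `E/ℚ` over a totally complex `K`, `κ` with topological generator `γ`, a finite `T ∋ 𝔭` (other
members `∤ p`) outside which the away conditions descend: `ControlUpperOnTreeAt p κ 𝔭 γ ι P`
(`Σ = ∅`) follows from (c) finiteness and bounds `#ker r_v ≤ p^{b v}` on `T` — now INCLUDING
`v = 𝔭`, where Greenberg's Lemma 3.3 above `p` gives `b 𝔭 = ord_p #E(K_𝔭)[p^∞]`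
(`BDPRouteLocalKernelAtP`) — and (d) `#Sel_𝔭(K, E[p^∞]) ≤ p^a`, provided
`a + ∑_{v∈T} b v ≤ ord_p #Ш(E/K)[p^∞] + 2((ord_p log_ω P − 1) − ord_p[E(K):ℤP]) + ord_p ∏_{w∣N⁺} c_w`.
NO hypothesis on the torsion of `E(K_{∞,w})`. CONDITIONAL; nothing booked.
[cite: Castella2018, Thm. 2.3 and its proof (arXiv:1704.06608 pp. 5–6)]
[cite: GreenbergLNM1716, §3 Lemma 3.3 (p. 87), p. 90] [cite: JetchevSkinnerWan2017, Prop. 3.2.1, §3.3 (shape only)] -/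
theorem controlUpperOnTreeAt_of_localKer_bounds_strict [IsTotallyComplex K]
    (T : Finset (HeightOneSpectrum (𝓞 K))) (h𝔭T : 𝔭 ∈ T)
    (hTp : ∀ v ∈ T, v ≠ 𝔭 → ((p : ℕ) : 𝓞 K) ∉ v.asIdeal)
    (hS : ∀ c : (W.baseChange K).subgroupH1 p (⊤ : Subgroup (Field.absoluteGaloisGroup K)),
      (W.baseChange K).resOfLe p (le_top : κ.kerSubgroup ≤ ⊤) c ∈
          selmerAc (W.baseChange K) p κ 𝔭 ∅ →
        ∀ v : HeightOneSpectrum (𝓞 K), ((p : ℕ) : 𝓞 K) ∉ v.asIdeal → v ∉ (∅ : Set _) → v ∉ T →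
          c ∈ awayKer ⊤ ((W.baseChange K).geomPrimaryTorsion p) v)
    [Finite (selmerAcBase (W.baseChange K) p 𝔭 ∅)]
    (hfin : ∀ v ∈ T, Finite (localKer κ.kerSubgroup ((W.baseChange K).geomPrimaryTorsion p) v))
    {a : ℕ} (ha : Nat.card (selmerAcBase (W.baseChange K) p 𝔭 ∅) ≤ p ^ a)
    {b : HeightOneSpectrum (𝓞 K) → ℕ}
    (hb : ∀ v ∈ T,
      Nat.card (localKer κ.kerSubgroup ((W.baseChange K).geomPrimaryTorsion p) v) ≤ p ^ b v)
    {P : (W.baseChange K).toAffine.Point}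
    (hm : ((a + ∑ v ∈ T, b v : ℕ) : ℤ) ≤ (padicValNat p
        (Nat.card (AddCommGroup.primaryComponent (W.baseChange K).sha p)) : ℤ) +
      2 * ((padicLogOrd W p ι P - 1) - (padicValNat p (AddSubgroup.zmultiples P).index : ℤ)) +
        padicValNat p (tamagawaProductSplit W K)) :
    ControlUpperOnTreeAt p κ 𝔭 γ ι P := by
  obtain ⟨hfinγ, hle⟩ := natCard_endInvariants_le_pow_of_localKer_strict
    (W := W.baseChange K) (S := (∅ : Set (HeightOneSpectrum (𝓞 K))))
    (Fact.out : κ.IsTopGenerator γ) T h𝔭T hTp (fun v _ ↦ Set.notMem_empty v) hS hfin ha hb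
  exact controlUpperOnTreeAt_of_natCard_invariants_le hfinγ hle hm

end RouteP2

end Summit.BirchSwinnertonDyer.Rank1Residual.X11b

end
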